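import Summits.AnomalousDissipation.AnomalousDissipation.Theorems.TaylorCertificatesSteadyStatesLoudBoundedStubCompactnessSplit
import Literature.Analysis.FluidPDE.StatisticalSolutionEnergyEq
import Literature.Analysis.FluidPDE.CheskidovGluedCalculus
import Literature.Analysis.FluidPDE.TorusForceBookkeeping
import Literature.Analysis.FunctionSpaces.TorusLinearisedFormTruncation
import Literature.Analysis.FunctionSpaces.TorusCalculusProofs
import HarnessLib

/-!
# Blow-down of FAT steady branches (tools lemma for the ceiling stub S2′ of line
# `lamb-floor-f123-shared-ceiling`, crux stmt-AnomalousDissipation-13038)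

Line lead `prover-line-stmt-AnomalousDissipation-13038-c2-0` (2026-08-17). The strategist's typed fact
`CensusSketchV3.FatBlowDown` (STRATEGY-CENSUS v3 §T7), PROVED: if `u_n` are smooth admissible classical
steady states of `NS_{ν_n}(f)` (`f` smooth) with `ν_n → 0⁺` and `ν_n² ∫|u_n|² ≥ c > 0` (a FAT sequence —
the object that kills every steady / ensemble CEILING at `f`), then the blow-downs `v_n := ν_n u_n`
satisfy `‖∇v_n‖² = (f, v_n) ≤ ‖f‖²/(4π²)` (energy identity × `ν_n`, Cauchy–Schwarz, Poincaré), hence lie in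
a compact enstrophy ball of `H` (Rellich, `Torus.isCompact_setOf_eGradNormSq_le`); every limit `U` of a
subsequence is a NONZERO (`‖U‖² ≥ c`) finite-enstrophy (`U ∈ V`) steady weak solution of the UNFORCED Euler
equations (`(v_n·∇)v_n + ∇q_n = ν_n² (f + Δ v_n)` tested against smooth `w`: the right side is `O(ν_n²)`),
and `‖∇U‖² ≤ liminf ‖∇v_n‖² = lim (f, v_n) = (U, f)` (lower semicontinuity of the spectral enstrophy on `H`).
So a fat branch can only exist on an `H¹`-SKELETON on which the force does positive work dominating the
enstrophy — the necessary condition that EVERY nonzero force meets through its own divergence-free Fourier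
modes (§T7: no ceiling is certifiable by first-order rigidity). Registered tools stub: `stub_fatBlowDownTools`
(last theorem, expanded signature). Elementary given the tree's Rellich/lsc/lift tools; [folklore].
-/

noncomputable section

-- `Summit.<Summit>.<Problem>` is the tree's mandated summit-side namespace (CONVENTIONS §2); single-conjunct summit, duplicate deliberate.
set_option linter.dupNamespace false

open MeasureTheory Filter Topology

namespace Summit.AnomalousDissipation.AnomalousDissipation.Theorems.SteadyStatesLoudBounded.FatBlowDown

open Literature.Analysis.FunctionSpaces Literature.Analysis.FunctionSpaces.Torus Literature.Analysis.FluidPDE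
  Literature.Analysis.FluidPDE.Torus
open Summit.AnomalousDissipation.AnomalousDissipation.Theorems.SteadyStatesLoudBounded.CompactnessSplit
open scoped InnerProductSpace ENNReal

/-! ## `L²` and steady-state tools on smooth fields -/

/-- **Cauchy–Schwarz for pairings of `L²` fields**: `|∫ ⟪a, w⟫| ≤ √(∫ ‖a‖²) · √(∫ ‖w‖²)`
(private copy of `Literature.Analysis.FluidPDE.abs_integral_inner_le_sqrt_mul_sqrt`, kept local to keep
the import cone small). -/
private theorem abs_integral_inner_le_sqrt_mul_sqrt' {a w : UnitAddTorus (Fin 3) → EuclideanSpace ℝ (Fin 3)}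
    (ha : MemLp a 2 volume) (hw : MemLp w 2 volume) :
    |∫ x, ⟪a x, w x⟫_ℝ| ≤ Real.sqrt (∫ x, ‖a x‖ ^ 2) * Real.sqrt (∫ x, ‖w x‖ ^ 2) := by
  have h1 : |∫ x, ⟪a x, w x⟫_ℝ| ≤ ∫ x, ‖a x‖ * ‖w x‖ := by
    rw [← Real.norm_eq_abs]
    refine (norm_integral_le_integral_norm _).trans (integral_mono_of_nonneg
      (ae_of_all _ fun x => norm_nonneg _) (ha.norm.integrable_mul hw.norm)
      (ae_of_all _ fun x => norm_inner_le_norm _ _))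
  have h2 := integral_mul_le_Lp_mul_Lq_of_nonneg Real.HolderConjugate.two_two
    (ae_of_all _ fun x => norm_nonneg (a x)) (ae_of_all _ fun x => norm_nonneg (w x))
    (by simpa using ha.norm) (by simpa using hw.norm)
  refine h1.trans (h2.trans_eq ?_)
  simp only [Real.rpow_two, one_div, Real.sqrt_eq_rpow]

/-- **The tested steady equation, solved for the inertial term**: at a smooth divergence-free classical steady
state `u` of `NS_ν(f)` (the crux's weak form), `∫⟪(u·∇)u, w⟫ = ν ∫⟪u, Δw⟫ + ∫⟪f, w⟫` for every smooth `w`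
admitted by the weak form (Green's second identity for the viscous term). -/
theorem integral_inner_convect_eq_of_steady {ν : ℝ} {f u w : UnitAddTorus (Fin 3) → EuclideanSpace ℝ (Fin 3)}
    (hf : IsSmooth f) (hu : IsSmooth u) (hw : IsSmooth w)
    (hs : ∫ x, ⟪ν • laplacian u x - convect u u x + f x, w x⟫_ℝ = 0) :
    ∫ x, ⟪convect u u x, w x⟫_ℝ = ν * (∫ x, ⟪u x, laplacian w x⟫_ℝ) + ∫ x, ⟪f x, w x⟫_ℝ := by
  have iL : Integrable (fun x => ⟪ν • laplacian u x, w x⟫_ℝ) volume :=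
    ((hu.laplacian.smul ν).inner hw).integrable
  have iC : Integrable (fun x => ⟪convect u u x, w x⟫_ℝ) volume := ((hu.convect hu).inner hw).integrable
  have iF : Integrable (fun x => ⟪f x, w x⟫_ℝ) volume := (hf.inner hw).integrable
  have hlap : ∫ x, ⟪ν • laplacian u x, w x⟫_ℝ = ν * ∫ x, ⟪u x, laplacian w x⟫_ℝ := by
    simp_rw [real_inner_smul_left, integral_const_mul]
    rw [integral_inner_laplacian_comm hu hw]
  have iLC : Integrable (fun x => ⟪ν • laplacian u x, w x⟫_ℝ - ⟪convect u u x, w x⟫_ℝ) volume := iL.sub iC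
  simp_rw [inner_add_left, inner_sub_left] at hs
  rw [integral_add iLC iF, integral_sub iL iC, hlap] at hs
  linarith

/-- **Energy identity at a smooth classical steady state** (test the weak form with `w = u`):
`ν ‖∇u‖² = (f, u)` (`∫⟪u, Δu⟫ = -‖∇u‖²`, `∫⟪(u·∇)u, u⟫ = 0`). -/
theorem energy_identity_of_steady {ν : ℝ} {f u : UnitAddTorus (Fin 3) → EuclideanSpace ℝ (Fin 3)}
    (hf : IsSmooth f) (hu : IsSmooth u) (hdiv : IsDivFree u)
    (hs : ∫ x, ⟪ν • laplacian u x - convect u u x + f x, u x⟫_ℝ = 0) :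
    ν * gradNormSq u = ∫ x, ⟪f x, u x⟫_ℝ := by
  have h := integral_inner_convect_eq_of_steady hf hu hu hs
  rw [integral_inner_convect_self_eq_zero hu hdiv, integral_inner_laplacian_eq_neg_holds hu] at h
  have hG : gradNormSq u = ∑ i, ∫ x, ‖partialDeriv i u x‖ ^ 2 := by
    unfold gradNormSq
    exact integral_finsetSum _ fun i _ => (hu.partialDeriv i).norm_sq.integrable
  rw [hG]
  linarith

/-- `‖∇(c u)‖² = c² ‖∇u‖²` for a smooth field. -/
theorem gradNormSq_const_smul {u : UnitAddTorus (Fin 3) → EuclideanSpace ℝ (Fin 3)} (hu : IsSmooth u) (c : ℝ) :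
    gradNormSq (fun y => c • u y) = c ^ 2 * gradNormSq u := by
  unfold gradNormSq
  rw [← integral_const_mul]
  refine integral_congr_ae (ae_of_all _ fun x => ?_)
  dsimp only
  rw [Finset.mul_sum]
  refine Finset.sum_congr rfl fun i _ => ?_
  have h : partialDeriv i (fun y => c • u y) x = c • partialDeriv i u x := by
    rw [show (fun y => c • u y) = c • u from rfl, Torus.partialDeriv_const_smul (hu.isContDiff (by simp)) c i]
    rfl
  rw [h, norm_smul, mul_pow, Real.norm_eq_abs, sq_abs]

/-- `∫ ‖c u‖² = c² ∫ ‖u‖²`. -/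
theorem integral_norm_sq_const_smul (u : UnitAddTorus (Fin 3) → EuclideanSpace ℝ (Fin 3)) (c : ℝ) :
    ∫ x, ‖c • u x‖ ^ 2 = c ^ 2 * ∫ x, ‖u x‖ ^ 2 := by
  rw [← integral_const_mul]
  refine integral_congr_ae (ae_of_all _ fun x => ?_)
  dsimp only
  rw [norm_smul, mul_pow, Real.norm_eq_abs, sq_abs]

/-- `∫ ⟪f, c u⟫ = c ∫ ⟪f, u⟫`. -/
theorem integral_inner_const_smul_right (f u : UnitAddTorus (Fin 3) → EuclideanSpace ℝ (Fin 3)) (c : ℝ) :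
    ∫ x, ⟪f x, c • u x⟫_ℝ = c * ∫ x, ⟪f x, u x⟫_ℝ := by
  rw [← integral_const_mul]
  refine integral_congr_ae (ae_of_all _ fun x => ?_)
  dsimp only
  rw [real_inner_smul_right]

/-! ## The blow-down -/

/-- **Blow-down bound.** For a smooth admissible classical steady state `u` of `NS_ν(f)`, `0 < ν`, the blow-down
`v = ν u` has `‖∇v‖² = (f, v)` and `‖∇v‖² ≤ ‖f‖₂²/(4π²)` (any real `ν`). -/
theorem blowDown_bound {ν : ℝ} {f u : UnitAddTorus (Fin 3) → EuclideanSpace ℝ (Fin 3)}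
    (hf : IsSmooth f) (hu : IsSmooth u) (hdiv : IsDivFree u) (h0 : HasZeroMean u)
    (hs : ∫ x, ⟪ν • laplacian u x - convect u u x + f x, u x⟫_ℝ = 0) :
    gradNormSq (fun y => ν • u y) = ∫ x, ⟪f x, ν • u x⟫_ℝ ∧
      gradNormSq (fun y => ν • u y) ≤ (∫ x, ‖f x‖ ^ 2) / (4 * Real.pi ^ 2) := by
  have hE := energy_identity_of_steady hf hu hdiv hs
  have hG : gradNormSq (fun y => ν • u y) = ∫ x, ⟪f x, ν • u x⟫_ℝ := by
    rw [gradNormSq_const_smul hu, integral_inner_const_smul_right, ← hE]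
    ring
  refine ⟨hG, ?_⟩
  -- `G = (f, v) ≤ ‖f‖ ‖v‖ ≤ ‖f‖ √G/(2π)`
  have hv : IsSmooth (fun y => ν • u y) := hu.smul ν
  have hv0 : HasZeroMean (fun y => ν • u y) := hasZeroMean_const_smul h0 ν
  set G := gradNormSq (fun y => ν • u y) with hGdef
  have hGnn : 0 ≤ G := gradNormSq_nonneg _
  have hF : 0 ≤ ∫ x, ‖f x‖ ^ 2 := integral_nonneg fun _ => sq_nonneg _
  have hcs : G ≤ Real.sqrt (∫ x, ‖f x‖ ^ 2) * Real.sqrt (∫ x, ‖ν • u x‖ ^ 2) := by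
    rw [hG]
    exact (le_abs_self _).trans (abs_integral_inner_le_sqrt_mul_sqrt' (hf.memLp 2) (hv.memLp 2))
  have hP : Real.sqrt (∫ x, ‖ν • u x‖ ^ 2) ≤ Real.sqrt G / (2 * Real.pi) :=
    sqrt_integral_norm_sq_le_of_hasZeroMean hv hv0
  have hπ : 0 < 2 * Real.pi := Real.two_pi_pos
  set a := Real.sqrt (∫ x, ‖f x‖ ^ 2) with ha
  have ha0 : 0 ≤ a := Real.sqrt_nonneg _
  have h1 : G ≤ a * (Real.sqrt G / (2 * Real.pi)) := hcs.trans (mul_le_mul_of_nonneg_left hP ha0)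
  -- `√G ≤ a/(2π)`, then square
  have hsG : Real.sqrt G * Real.sqrt G = G := Real.mul_self_sqrt hGnn
  have h2 : Real.sqrt G ≤ a / (2 * Real.pi) := by
    by_cases hG0 : Real.sqrt G = 0
    · rw [hG0]; positivity
    · have hpos : 0 < Real.sqrt G := lt_of_le_of_ne (Real.sqrt_nonneg _) (Ne.symm hG0)
      rw [le_div_iff₀ hπ]
      have h3 : Real.sqrt G * Real.sqrt G ≤ a * Real.sqrt G / (2 * Real.pi) := by
        rw [hsG]; simpa [mul_div_assoc] using h1
      rw [le_div_iff₀ hπ] at h3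
      nlinarith
  have h4 : G = Real.sqrt G ^ 2 := by rw [sq, hsG]
  have h5 : Real.sqrt G ^ 2 ≤ (a / (2 * Real.pi)) ^ 2 := pow_le_pow_left₀ (Real.sqrt_nonneg _) h2 2
  have h6 : (a / (2 * Real.pi)) ^ 2 = (∫ x, ‖f x‖ ^ 2) / (4 * Real.pi ^ 2) := by
    rw [div_pow, ha, Real.sq_sqrt hF]
    ring
  linarith [h4, h5, h6]

/-- **The blown-down inertial term is `O(ν²)`**: `∫⟪(v·∇)v, w⟫ = ν² (ν ∫⟪u, Δw⟫ + ∫⟪f, w⟫)` for `v = ν u`. -/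
theorem integral_inner_convect_blowDown {ν : ℝ} {f u w : UnitAddTorus (Fin 3) → EuclideanSpace ℝ (Fin 3)}
    (hf : IsSmooth f) (hu : IsSmooth u) (hw : IsSmooth w)
    (hs : ∫ x, ⟪ν • laplacian u x - convect u u x + f x, w x⟫_ℝ = 0) :
    ∫ x, ⟪convect (fun y => ν • u y) (fun y => ν • u y) x, w x⟫_ℝ =
      ν ^ 2 * (ν * (∫ x, ⟪u x, laplacian w x⟫_ℝ) + ∫ x, ⟪f x, w x⟫_ℝ) := by
  rw [← integral_inner_convect_eq_of_steady hf hu hw hs, ← integral_const_mul]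
  refine integral_congr_ae (ae_of_all _ fun x => ?_)
  dsimp only
  rw [Literature.Analysis.FluidPDE.Gluing.convect_smul_smul (hu.isContDiff (by simp)) ν ν x, real_inner_smul_left, sq]

/-- **`stub_fatBlowDownTools` — BLOW-DOWN OF FAT STEADY SEQUENCES (tools stub, lead c2, for S2′).** Let `f` be smooth and
let `u_n` be smooth divergence-free mean-zero classical steady states of `NS_{ν_n}(f)` (the crux's weak form) with
`0 < ν_n → 0` and `c ≤ ν_n² ∫|u_n|²` for some `c > 0`. Then there is a state `U ∈ V ⊆ H` which is a steady weak
solution of the UNFORCED Euler equations (`Torus.IsSteadyWeakSolution 0 0 U`), is nonzero (`c ≤ ‖U‖²`), and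
satisfies the skeleton inequality `‖∇U‖² ≤ (U, f)` (spectral enstrophy against the `L²` pairing). -/
theorem stub_fatBlowDownTools :
    ∀ (f : UnitAddTorus (Fin 3) → EuclideanSpace ℝ (Fin 3)) (ν : ℕ → ℝ)
      (u : ℕ → UnitAddTorus (Fin 3) → EuclideanSpace ℝ (Fin 3)) (c : ℝ),
      Torus.IsSmooth f → (∀ n, 0 < ν n) → Filter.Tendsto ν Filter.atTop (nhds 0) →
      (∀ n, Torus.IsSmooth (u n) ∧ Torus.IsDivFree (u n) ∧ Torus.HasZeroMean (u n) ∧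
        ∀ w : UnitAddTorus (Fin 3) → EuclideanSpace ℝ (Fin 3), Torus.IsSmooth w → Torus.IsDivFree w →
          Torus.HasZeroMean w →
          ∫ x, inner ℝ (ν n • Torus.laplacian (u n) x - Torus.convect (u n) (u n) x + f x) (w x) = 0) →
      0 < c → (∀ n, c ≤ ν n ^ 2 * ∫ x, ‖u n x‖ ^ 2) →
      ∃ U : Torus.energySpace (Fin 3),
        (U : Lp (EuclideanSpace ℝ (Fin 3)) 2 (volume : Measure (UnitAddTorus (Fin 3)))) ∈ Torus.energySpaceV (Fin 3) ∧
        Torus.IsSteadyWeakSolution 0 (fun _ => 0) U ∧ c ≤ ‖U‖ ^ 2 ∧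
        (Torus.eGradNormSq ((U : Lp (EuclideanSpace ℝ (Fin 3)) 2 (volume : Measure (UnitAddTorus (Fin 3)))) :
            UnitAddTorus (Fin 3) → EuclideanSpace ℝ (Fin 3))).toReal ≤
          Torus.pairing (U : Lp (EuclideanSpace ℝ (Fin 3)) 2 (volume : Measure (UnitAddTorus (Fin 3)))) f := by
  intro f ν u c hf hν hν0 hseq hc hfat
  have hus : ∀ n, IsSmooth (u n) := fun n => (hseq n).1
  have hud : ∀ n, IsDivFree (u n) := fun n => (hseq n).2.1
  have huz : ∀ n, HasZeroMean (u n) := fun n => (hseq n).2.2.1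
  have hst : ∀ n (w : UnitAddTorus (Fin 3) → EuclideanSpace ℝ (Fin 3)), IsSmooth w → IsDivFree w → HasZeroMean w →
      ∫ x, ⟪ν n • laplacian (u n) x - convect (u n) (u n) x + f x, w x⟫_ℝ = 0 := fun n => (hseq n).2.2.2
  -- the blow-downs `v n = ν n • u n`
  set v : ℕ → UnitAddTorus (Fin 3) → EuclideanSpace ℝ (Fin 3) := fun n y => ν n • u n y with hvdef
  have hvs : ∀ n, IsSmooth (v n) := fun n => (hus n).smul (ν n)
  have hvd : ∀ n, IsDivFree (v n) := fun n =>
    isDivFree_const_smul ((hus n).isContDiff (by simp)) (hud n) (ν n)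
  have hvz : ∀ n, HasZeroMean (v n) := fun n => hasZeroMean_const_smul (huz n) (ν n)
  set B : ℝ := (∫ x, ‖f x‖ ^ 2) / (4 * Real.pi ^ 2) with hBdef
  have hbd : ∀ n, gradNormSq (v n) = ∫ x, ⟪f x, v n x⟫_ℝ ∧ gradNormSq (v n) ≤ B := fun n =>
    blowDown_bound hf (hus n) (hud n) (huz n) (hst n (u n) (hus n) (hud n) (huz n))
  -- lifts to `H`, inside the compact enstrophy ball `{‖∇·‖² ≤ B}`
  choose U hU using fun n => exists_lift (hvs n) (hvd n) (hvz n)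
  set K : Set (energySpace (Fin 3)) :=
    {w | eGradNormSq (w.1 : UnitAddTorus (Fin 3) → EuclideanSpace ℝ (Fin 3)) ≤ ENNReal.ofReal B} with hK
  have hKc : IsCompact K := isCompact_setOf_eGradNormSq_le ENNReal.ofReal_ne_top
  have hUG : ∀ n, eGradNormSq ((U n).1 : UnitAddTorus (Fin 3) → EuclideanSpace ℝ (Fin 3)) =
      ENNReal.ofReal (gradNormSq (v n)) := fun n => eGradNormSq_of_lift (hvs n) (hU n)
  have hUK : ∀ n, U n ∈ K := fun n => by
    show eGradNormSq ((U n).1 : UnitAddTorus (Fin 3) → EuclideanSpace ℝ (Fin 3)) ≤ ENNReal.ofReal B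
    rw [hUG n]
    exact ENNReal.ofReal_le_ofReal (hbd n).2
  obtain ⟨v₀, hv₀K, ψ, hψ, hlim⟩ := hKc.tendsto_subseq hUK
  -- (1) the limit lies in `V`
  have hV : v₀.1 ∈ energySpaceV (Fin 3) := ⟨v₀.2,
    memSobolev_one_complexify_of_eGradNormSq_ne_top (Lp.memLp _)
      (ne_top_of_le_ne_top ENNReal.ofReal_ne_top hv₀K)⟩
  -- (2) the limit is nonzero: `‖U n‖² = ν_n² ∫|u_n|² ≥ c`
  have hnorm : ∀ n, c ≤ ‖U n‖ ^ 2 := fun n => by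
    rw [norm_sq_of_lift (hU n)]
    show c ≤ ∫ x, ‖ν n • u n x‖ ^ 2
    rw [integral_norm_sq_const_smul]
    exact hfat n
  have hc' : c ≤ ‖v₀‖ ^ 2 := by
    have h1 : Tendsto (fun n => ‖U (ψ n)‖ ^ 2) atTop (𝓝 (‖v₀‖ ^ 2)) :=
      ((continuous_norm.tendsto v₀).comp hlim).pow 2
    exact ge_of_tendsto' h1 fun n => hnorm _
  -- (3) the limit solves the unforced steady Euler equations weakly
  have hνψ : Tendsto (fun n => ν (ψ n)) atTop (𝓝 0) := hν0.comp hψ.tendsto_atTop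
  have hsol : IsSteadyWeakSolution 0 (fun _ => (0 : EuclideanSpace ℝ (Fin 3))) v₀ := by
    intro w hw hwd hwm
    have hA : Tendsto (fun n => nsGeneratorPairing 0 (fun _ => (0 : EuclideanSpace ℝ (Fin 3))) (U (ψ n)) w) atTop
        (𝓝 (nsGeneratorPairing 0 (fun _ => (0 : EuclideanSpace ℝ (Fin 3))) v₀ w)) :=
      ((continuous_nsGeneratorPairing 0 (fun _ => (0 : EuclideanSpace ℝ (Fin 3))) hw).tendsto v₀).comp hlim
    -- the generator at the lift of `v n` is `-∫⟪(v·∇)v, w⟫ = -ν²(ν ∫⟪u, Δw⟫ + ∫⟪f, w⟫)`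
    have hgen : ∀ n, nsGeneratorPairing 0 (fun _ => (0 : EuclideanSpace ℝ (Fin 3))) (U n) w =
        -(ν n ^ 2 * (ν n * (∫ x, ⟪u n x, laplacian w x⟫_ℝ) + ∫ x, ⟪f x, w x⟫_ℝ)) := by
      intro n
      rw [nsGeneratorPairing_zero_of_lift (isSmooth_const _) (hvs n) (hvd n) hw (hU n)]
      have h1 : ∫ x, ⟪convect (v n) (v n) x - (fun _ => (0 : EuclideanSpace ℝ (Fin 3))) x, w x⟫_ℝ =
          ∫ x, ⟪convect (v n) (v n) x, w x⟫_ℝ := by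
        refine integral_congr_ae (ae_of_all _ fun x => ?_)
        simp
      rw [h1]
      show -∫ x, ⟪convect (fun y => ν n • u n y) (fun y => ν n • u n y) x, w x⟫_ℝ = _
      rw [integral_inner_convect_blowDown hf (hus n) hw (hst n w hw hwd hwm)]
    -- `|∫⟪u_n, Δw⟫| ≤ ‖u_n‖ ‖Δw‖ ≤ √(‖∇u_n‖²)/(2π) ‖Δw‖` and `ν_n ‖∇u_n‖ ...`: bound `ν_n |∫⟪u_n, Δw⟫| ≤ √B/(2π) ‖Δw‖₂`
    set M : ℝ := Real.sqrt B / (2 * Real.pi) * Real.sqrt (∫ x, ‖laplacian w x‖ ^ 2) + |∫ x, ⟪f x, w x⟫_ℝ| with hM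
    have hM0 : 0 ≤ M := by positivity
    have hbound : ∀ n, ‖nsGeneratorPairing 0 (fun _ => (0 : EuclideanSpace ℝ (Fin 3))) (U n) w‖ ≤ ν n ^ 2 * M := by
      intro n
      rw [hgen n, norm_neg, Real.norm_eq_abs, abs_mul, abs_of_nonneg (sq_nonneg _)]
      refine mul_le_mul_of_nonneg_left ?_ (sq_nonneg _)
      -- `|ν ∫⟪u,Δw⟫ + ∫⟪f,w⟫| ≤ |∫⟪v, Δw⟫| + |∫⟪f,w⟫|`
      have hvint : ν n * (∫ x, ⟪u n x, laplacian w x⟫_ℝ) = ∫ x, ⟪v n x, laplacian w x⟫_ℝ := by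
        rw [← integral_const_mul]
        refine integral_congr_ae (ae_of_all _ fun x => ?_)
        show ν n * ⟪u n x, laplacian w x⟫_ℝ = ⟪ν n • u n x, laplacian w x⟫_ℝ
        rw [real_inner_smul_left]
      rw [hvint]
      refine (abs_add_le _ _).trans (add_le_add ?_ le_rfl)
      have hcs := abs_integral_inner_le_sqrt_mul_sqrt' ((hvs n).memLp 2) (hw.laplacian.memLp 2)
      refine hcs.trans (mul_le_mul_of_nonneg_right ?_ (Real.sqrt_nonneg _))
      exact (sqrt_integral_norm_sq_le_of_hasZeroMean (hvs n) (hvz n)).trans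
        (div_le_div_of_nonneg_right (Real.sqrt_le_sqrt (hbd n).2) Real.two_pi_pos.le)
    have hB' : Tendsto (fun n => nsGeneratorPairing 0 (fun _ => (0 : EuclideanSpace ℝ (Fin 3))) (U (ψ n)) w) atTop (𝓝 0) := by
      have h0 : Tendsto (fun n => ν (ψ n) ^ 2 * M) atTop (𝓝 0) := by
        have h := (hνψ.pow 2).mul_const M
        rw [zero_pow two_ne_zero, zero_mul] at h
        exact h
      exact squeeze_zero_norm (fun n => hbound (ψ n)) h0
    exact tendsto_nhds_unique hA hB'
  -- (4) the skeleton inequality `‖∇v₀‖² ≤ (v₀, f)` from lower semicontinuity of the enstrophy on `H`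
  have hP : ∀ n, pairing ((U n).1) f = gradNormSq (v n) := by
    intro n
    rw [(hbd n).1, pairing]
    refine integral_congr_ae ?_
    filter_upwards [hU n] with x hx
    rw [hx, real_inner_comm]
  have hPlim : Tendsto (fun n => gradNormSq (v (ψ n))) atTop (𝓝 (pairing (v₀.1) f)) := by
    have h := ((continuous_pairing_coe (hf.memLp 2)).tendsto v₀).comp hlim
    refine h.congr fun n => ?_
    show pairing ((U (ψ n)).1) f = gradNormSq (v (ψ n))
    exact hP _
  have hL0 : 0 ≤ pairing (v₀.1) f := ge_of_tendsto' hPlim fun n => gradNormSq_nonneg _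
  have hlsc : eGradNormSq (v₀.1 : UnitAddTorus (Fin 3) → EuclideanSpace ℝ (Fin 3)) ≤
      ENNReal.ofReal (pairing (v₀.1) f) := by
    have hof : Tendsto (fun n => eGradNormSq ((U (ψ n)).1 : UnitAddTorus (Fin 3) → EuclideanSpace ℝ (Fin 3))) atTop
        (𝓝 (ENNReal.ofReal (pairing (v₀.1) f))) := by
      have h := (ENNReal.continuous_ofReal.tendsto _).comp hPlim
      refine h.congr fun n => ?_
      show ENNReal.ofReal (gradNormSq (v (ψ n))) = eGradNormSq ((U (ψ n)).1 : UnitAddTorus (Fin 3) → EuclideanSpace ℝ (Fin 3))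
      exact (hUG _).symm
    refine le_of_forall_lt_imp_le_of_dense fun y hy => ?_
    have hev : ∀ᶠ n in atTop, y < eGradNormSq ((U (ψ n)).1 : UnitAddTorus (Fin 3) → EuclideanSpace ℝ (Fin 3)) :=
      hlim.eventually (lowerSemicontinuous_eGradNormSq_coe v₀ y hy)
    exact ge_of_tendsto hof (hev.mono fun n hn => hn.le)
  exact ⟨v₀, hV, hsol, hc', ENNReal.toReal_le_of_le_ofReal hL0 hlsc⟩

end Summit.AnomalousDissipation.AnomalousDissipation.Theorems.SteadyStatesLoudBounded.FatBlowDown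

end
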